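import Summits.BirchSwinnertonDyer.BirchSwinnertonDyer.Theorems.GoldfeldAllTwistsTwoConverseTwinOddTwoPrimesTwistSelmer
import Summits.BirchSwinnertonDyer.BirchSwinnertonDyer.Theorems.GoldfeldAllTwistsTwoConverseTwinAdditiveTwoPrimesTwistSelmerPOne
import Summits.BirchSwinnertonDyer.BirchSwinnertonDyer.Theorems.GoldfeldAllTwistsTwoConverseTwinAdditiveTwoAdicPOne
import HarnessLib

set_option linter.dupNamespace false -- namespace `…BirchSwinnertonDyer.BirchSwinnertonDyer…` is the cell's (D-0017 nested layout)
set_option autoImplicit false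

/-!
# Cells C7 ∪ C7A (`q ≡ 7 (8)`, `p ≡ 1 (8)`, `(p/q) = −1`), file D1-odd: the `2`-isogeny Selmer set `S(−21qp, 112q²p²)` of the ODD two-prime twist
# `49a1^{(−qp)}` has order `≤ 2` at `p ≡ 1 (mod 8)` — X0 part a1's twin, the classes `2, 14` dying at the prime `2` (FACT-FREE, type-free)

Cell `bsd-goldfeld`, seat `bsd-goldfeld-s1p-c3x` (gen 13); planner RULING (ccclx) «OBJECT C7A BY THE χ_Z CHANNEL», tranche T3, file D1-odd (memo
`HOME/C7A-CHIZ-CHANNEL.md` §3; the input of the `h2`-discharge D3). `--supports stmt-BirchSwinnertonDyer-20044` as a HELPER. Theses-free; theorems only; no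
definition, no fact binder, no `sorry`. FRONTIER-grade: a twist-density-ZERO sub-family; never distance-to-summit.

SETTING = X0 part a1 (`…TwinOddTwoPrimesTwistSelmer`, `p ≡ 5 (8)`) with `p ≡ 1 (mod 8)`: `E = ⟨0, −21qp, 0, 112q²p², 0⟩` (good at `2`, `−qp ≡ 1 (mod 8)`),
`S = S(−21qp, 112q²p²)`. KILL TABLE (kit j317613, 47/47 C7A rows, both `p mod 16` classes; identical on C7): negatives at `ℝ`; the eight `q`-classes at `q`;
`p, 7p, 2p, 14p` at `q` (`(p/q) = (2p/q) = −1`); `2, 14` at the prime `2` (D0-(L2) `not_isSoluble_two_class_two_odd` / `…_fourteen_odd`, `u = −qp ≡ 1 (8)`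
a `ℤ₂`-square — at `p ≡ 5 (8)` they died at `p` by `(2/p) = −1`, which is `+1` here) ⇒ `S ⊆ {1, 7}`, `#S ≤ 2`.
* §1 `oddTwoPrimes_facts_pOne` (the symbols, `(2/p) = +1`); §2 `card_twoIsogenySelmerGroup_oddTwoPrimesTwist_le_pOne` (`#S ≤ 2`).
HONEST FRAMING: a Selmer-set count; nothing about `L`-values; items 19140 / 20044 unchanged; BSD is not proved by any of this.

References: [SilvermanAEC2009] X.4.9–X.4.10; [Zywina2025] Lemma 3.1 (proof); [Serre1973] Ch. II §3.3 Thm 4.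
-/

noncomputable section

open scoped Classical

open Literature.NumberTheory.EllipticCurves
open Literature.NumberTheory.EllipticCurves.Zywina2025 (isSquare_zmod_of_isSoluble_padic)

namespace Summit.BirchSwinnertonDyer.BirchSwinnertonDyer.Theorems.GoldfeldGoodTwists

section OddSelmerPOne
variable {q p : ℕ} [Fact q.Prime] [Fact p.Prime]

/-- A natural number not divisible by the prime `ℓ` is non-zero in `ZMod ℓ`, as an integer cast. [folklore] -/
private theorem intCast_ne_zero_of_not_dvd_oddPOne {l : ℕ} [Fact l.Prime] {n : ℕ} (h : ¬ l ∣ n) : ((n : ℤ) : ZMod l) ≠ 0 := by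
  rw [Int.cast_natCast, Ne, ZMod.natCast_eq_zero_iff]; exact h

/-- A prime `ℓ ≠ 2, 7` divides no `2^a·7^b`. [folklore] -/
private theorem not_dvd_two_pow_mul_seven_pow_oddPOne {l : ℕ} (hl : l.Prime) (hl2 : l ≠ 2) (hl7 : l ≠ 7) (a b : ℕ) :
    ¬ l ∣ 2 ^ a * 7 ^ b := by
  intro h
  rcases (Nat.Prime.dvd_mul hl).mp h with h | h
  · exact hl2 ((Nat.prime_dvd_prime_iff_eq hl Nat.prime_two).mp (hl.dvd_of_dvd_pow h))
  · exact hl7 ((Nat.prime_dvd_prime_iff_eq hl (by norm_num)).mp (hl.dvd_of_dvd_pow h))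

/-! ## §1 The symbols at `p ≡ 1 (mod 8)` -/

/-- The family's symbols and non-vanishings (`q ≡ 7 (8)`, `(q/7) = −1`; `p ≡ 1 (8)`, `(−7/p) = 1`; `(p/q) = −1`): `q, p ∉ {2, 7}` distinct, `7 ∤ qp`,
`(q/7)_L = −1`, `(p/7)_L = 1`, `(2/p) = +1`, `(7/p) = (−1/p) = 1`, `(q/p) = −1`, `(7/q) = (2/q) = 1`, `(−7/q) = (p/q) = −1`. [folklore] -/
theorem oddTwoPrimes_facts_pOne (hq8 : q % 8 = 7) (hq7 : jacobiSym q 7 = -1) (hp8 : p % 8 = 1) (hp7 : legendreSym p (-7) = 1)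
    (hpq : jacobiSym p q = -1) :
    (q ≠ 2 ∧ p ≠ 2 ∧ q ≠ p ∧ ¬ 7 ∣ q * p ∧ ¬ (7 : ℤ) ∣ q ∧ ¬ (7 : ℤ) ∣ p) ∧
    (legendreSym 7 q = -1 ∧ legendreSym 7 p = 1 ∧ ((q : ℤ) : ZMod 7) ≠ 0 ∧ ((p : ℤ) : ZMod 7) ≠ 0) ∧
    (legendreSym p 2 = 1 ∧ legendreSym p 7 = 1 ∧ legendreSym p (-1) = 1 ∧ legendreSym p q = -1) ∧
    (legendreSym q 7 = 1 ∧ legendreSym q (-7) = -1 ∧ legendreSym q 2 = 1 ∧ legendreSym q p = -1) ∧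
    (((q : ℤ) : ZMod p) ≠ 0 ∧ ((p : ℤ) : ZMod q) ≠ 0) := by
  have hq : q.Prime := Fact.out
  have hp : p.Prime := Fact.out
  haveI : Fact (Nat.Prime 7) := ⟨by norm_num⟩
  have hq4 : q % 4 = 3 := by omega
  have hq2 : q ≠ 2 := by rintro rfl; norm_num at hq8
  have hp2 : p ≠ 2 := by rintro rfl; norm_num at hp8
  have hqp : q ≠ p := by rintro rfl; omega
  have hq7' : q ≠ 7 := by rintro rfl; rw [jacobiSym.mod_left] at hq7; norm_num at hq7
  have hp7' : p ≠ 7 := by rintro rfl; norm_num at hp8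
  have h7Q : ¬ (7 : ℤ) ∣ q := fun h ↦ hq7' ((Nat.prime_dvd_prime_iff_eq (by norm_num) hq).mp (by exact_mod_cast h)).symm
  have h7P : ¬ (7 : ℤ) ∣ p := fun h ↦ hp7' ((Nat.prime_dvd_prime_iff_eq (by norm_num) hp).mp (by exact_mod_cast h)).symm
  have h7qp : ¬ 7 ∣ q * p := fun h ↦ ((Nat.Prime.dvd_mul (by norm_num)).mp h).elim (fun h ↦ h7Q (by exact_mod_cast h))
    (fun h ↦ h7P (by exact_mod_cast h))
  obtain ⟨h2p, h7p, hm1p⟩ := legendreSym_two_seven_neg_one_of_one_mod_eight hp8 hp7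
  obtain ⟨hqp_p, hpq_q⟩ := legendreSym_swap_of_one_mod_four (q := q) (p := p) (by omega) hqp hq2 hpq
  obtain ⟨h7q, hm7q⟩ := legendreSym_seven_and_neg_seven_of_three_mod_four hq4 hq7
  have h7_q : legendreSym 7 q = -1 := by rw [jacobiSym.legendreSym.to_jacobiSym]; exact_mod_cast hq7
  have h7_p : legendreSym 7 p = 1 := by
    rw [legendreSym.quadratic_reciprocity_one_mod_four (by omega : p % 4 = 1) (by norm_num : 7 ≠ 2)]; exact h7p
  have hq07 : ((q : ℤ) : ZMod 7) ≠ 0 := by rw [Ne, ZMod.intCast_zmod_eq_zero_iff_dvd]; exact_mod_cast h7Q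
  have hp07 : ((p : ℤ) : ZMod 7) ≠ 0 := by rw [Ne, ZMod.intCast_zmod_eq_zero_iff_dvd]; exact_mod_cast h7P
  have h2q : legendreSym q 2 = 1 := by
    rw [legendreSym.at_two hq2, ZMod.χ₈_nat_eq_if_mod_eight]; simp [hq8, show q % 2 = 1 by omega]
  have hqp0 : ((q : ℤ) : ZMod p) ≠ 0 :=
    intCast_ne_zero_of_not_dvd_oddPOne (l := p) (fun h ↦ hqp ((Nat.prime_dvd_prime_iff_eq hp hq).mp h).symm)
  have hpq0 : ((p : ℤ) : ZMod q) ≠ 0 :=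
    intCast_ne_zero_of_not_dvd_oddPOne (l := q) (fun h ↦ hqp ((Nat.prime_dvd_prime_iff_eq hq hp).mp h))
  exact ⟨⟨hq2, hp2, hqp, h7qp, h7Q, h7P⟩, ⟨h7_q, h7_p, hq07, hp07⟩, ⟨h2p, h7p, hm1p, hqp_p⟩, ⟨h7q, hm7q, h2q, hpq_q⟩, ⟨hqp0, hpq0⟩⟩

/-! ## §2 `#S(−21qp, 112q²p²) ≤ 2` at `p ≡ 1 (mod 8)`: `S ⊆ {1, 7}` (the classes `2, 14` now die at the prime `2`) -/

set_option maxHeartbeats 400000 in -- sixteen positive classes, each with its local computation (as T3-D part 2)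
/-- **`#S(−21qp, 112q²p²) ≤ 2`** for `q ≡ 7 (8)` prime, `(q/7) = −1`, `p ≡ 1 (8)` prime, `(−7/p) = 1`, `(p/q) = −1`: `S ⊆ {1, 7}` (the `q`-classes at `q`, the
`p`-classes at `q` by `(p/q) = −1`, negatives at `ℝ` — as X0 part a1 —, and `2, 14` at the prime `2` by D0-(L2), `u = −qp ≡ 1 (mod 8)`).
[cite: SilvermanAEC2009, Prop. X.4.9 and Example X.4.10] -/
theorem card_twoIsogenySelmerGroup_oddTwoPrimesTwist_le_pOne (hq8 : q % 8 = 7) (hq7 : jacobiSym q 7 = -1) (hp8 : p % 8 = 1)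
    (hp7 : legendreSym p (-7) = 1) (hpq : jacobiSym p q = -1) :
    (twoIsogenySelmerGroup (-21 * ((q : ℤ) * p)) (112 * ((q : ℤ) * p) ^ 2)).card ≤ 2 := by
  have hq : q.Prime := Fact.out
  have hp : p.Prime := Fact.out
  have hqZ : Prime (q : ℤ) := Nat.prime_iff_prime_int.mp hq
  have hpZ : Prime (p : ℤ) := Nat.prime_iff_prime_int.mp hp
  have hq0 : (q : ℤ) ≠ 0 := by exact_mod_cast hq.ne_zero
  have hp0 : (p : ℤ) ≠ 0 := by exact_mod_cast hp.ne_zero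
  obtain ⟨⟨hq2, hp2, hqp, -, -, -⟩, -, ⟨h2p, h7p, -, hqp_p⟩, ⟨h7q, hm7q, h2q, hpq_q⟩, ⟨hqp0, hpq0⟩⟩ := oddTwoPrimes_facts_pOne hq8 hq7 hp8 hp7 hpq
  have hq7' : q ≠ 7 := by rintro rfl; rw [jacobiSym.mod_left] at hq7; norm_num at hq7
  have hp7' : p ≠ 7 := by rintro rfl; norm_num at hp8
  -- `u = −qp ≡ 1 (mod 8)` for the `2`-adic kills of `2, 14`
  have h8u : (8 : ℤ) ∣ -((q : ℤ) * p) - 1 := by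
    have hqp8 : (q * p) % 8 = 7 := by rw [Nat.mul_mod, hq8, hp8]
    have h8n : (8 : ℤ) ∣ ((q * p : ℕ) : ℤ) + 1 := by omega
    have e : -((q : ℤ) * p) - 1 = -( ((q * p : ℕ) : ℤ) + 1) := by push_cast; ring
    rw [e]; exact (dvd_neg).mpr h8n
  have hcq : ∀ a b : ℕ, (((2 ^ a * 7 ^ b : ℕ) : ℤ) : ZMod q) ≠ 0 := fun a b ↦
    intCast_ne_zero_of_not_dvd_oddPOne (not_dvd_two_pow_mul_seven_pow_oddPOne hq hq2 hq7' a b)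
  have hcp : ∀ a b : ℕ, (((2 ^ a * 7 ^ b : ℕ) : ℤ) : ZMod p) ≠ 0 := fun a b ↦
    intCast_ne_zero_of_not_dvd_oddPOne (not_dvd_two_pow_mul_seven_pow_oddPOne hp hp2 hp7' a b)
  have h4q : ((4 : ℤ) : ZMod q) ≠ 0 := by have := hcq 2 0; norm_num at this; exact_mod_cast this
  have h2q0 : ((2 : ℤ) : ZMod q) ≠ 0 := by have := hcq 1 0; norm_num at this; exact_mod_cast this
  have hpq' : (((p : ℤ) : ℤ) : ZMod q) ≠ 0 := hpq0
  have h2qp : ((2 * q : ℤ) : ZMod p) ≠ 0 := by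
    have h2 := hcp 1 0; norm_num at h2; push_cast; exact mul_ne_zero (by exact_mod_cast h2) (by exact_mod_cast hqp0)
  have h4qp : ((4 * q : ℤ) : ZMod p) ≠ 0 := by
    have h4 := hcp 2 0; norm_num at h4; push_cast; exact mul_ne_zero (by exact_mod_cast h4) (by exact_mod_cast hqp0)
  have hpq4 : ((p : ℤ) : ZMod q) ≠ 0 := hpq0
  -- the non-residues
  have hns_p_q : ¬ IsSquare (((p : ℤ)) : ZMod q) := (legendreSym.eq_neg_one_iff q).mp hpq_q
  have hns_7p_q : ¬ IsSquare (((7 * p : ℤ)) : ZMod q) :=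
    (legendreSym.eq_neg_one_iff q).mp (by rw [legendreSym.mul, h7q, hpq_q]; norm_num)
  have hns_2p_q : ¬ IsSquare ((((p : ℤ) * 2 : ℤ)) : ZMod q) :=
    (legendreSym.eq_neg_one_iff q).mp (by rw [legendreSym.mul, hpq_q, h2q]; norm_num)
  have hns_14p_q : ¬ IsSquare ((((p : ℤ) * 14 : ℤ)) : ZMod q) :=
    (legendreSym.eq_neg_one_iff q).mp (by
      rw [show ((p : ℤ) * 14 : ℤ) = p * 7 * 2 by ring, legendreSym.mul, legendreSym.mul, hpq_q, h7q, h2q]; norm_num)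
  have hns_112p_q : ¬ IsSquare (((112 * p : ℤ)) : ZMod q) := by
    rw [show (112 * p : ℤ) = 7 * p * 4 ^ 2 by ring]; exact not_isSquare_mul_sq_zmod h4q hns_7p_q
  have hns_16p_q : ¬ IsSquare (((16 * p : ℤ)) : ZMod q) := by
    rw [show (16 * p : ℤ) = p * 4 ^ 2 by ring]; exact not_isSquare_mul_sq_zmod h4q hns_p_q
  have hns_56p_q : ¬ IsSquare (((56 * p : ℤ)) : ZMod q) := by
    rw [show (56 * p : ℤ) = p * 14 * 2 ^ 2 by ring]; exact not_isSquare_mul_sq_zmod h2q0 hns_14p_q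
  have hns_8p_q : ¬ IsSquare (((8 * p : ℤ)) : ZMod q) := by
    rw [show (8 * p : ℤ) = p * 2 * 2 ^ 2 by ring]; exact not_isSquare_mul_sq_zmod h2q0 hns_2p_q
  have hns_disc_q : ¬ IsSquare ((((-21 * p) ^ 2 - 4 * (112 * p ^ 2) : ℤ)) : ZMod q) := by
    rw [show ((-21 * p) ^ 2 - 4 * (112 * p ^ 2) : ℤ) = -7 * p ^ 2 by ring]
    exact not_isSquare_mul_sq_zmod hpq4 ((legendreSym.eq_neg_one_iff q).mp hm7q)
  have hb : (112 * ((q : ℤ) * p) ^ 2 : ℤ) ≠ 0 := by positivity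
  ------------------------------------------------------------------ `S ⊆ {1, 7}`
  have hsub : twoIsogenySelmerGroup (-21 * ((q : ℤ) * p)) (112 * ((q : ℤ) * p) ^ 2) ⊆ ({1, 7} : Finset ℤ) := by
    intro d hd
    rw [mem_twoIsogenySelmerGroup_iff hb] at hd
    obtain ⟨hsqf, ⟨d', hdd'⟩, hloc⟩ := hd
    have hd'eq : (112 * ((q : ℤ) * p) ^ 2 : ℤ) / d = d' := by rw [hdd', Int.mul_ediv_cancel_left _ hsqf.ne_zero]
    rw [hd'eq] at hloc
    obtain ⟨hreal, hpadic⟩ := hloc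
    -- negatives die at `ℝ`
    have hdpos : 0 < d := by
      rcases lt_or_gt_of_ne hsqf.ne_zero with hneg | hpos
      · exfalso
        have hbpos : (0 : ℤ) < 112 * ((q : ℤ) * p) ^ 2 := by positivity
        have hd'neg : d' < 0 := by
          by_contra hcon
          nlinarith [mul_nonpos_iff.mpr (Or.inr ⟨hneg.le, le_of_not_gt hcon⟩)]
        have ha : (-21 * ((q : ℤ) * p)) ≤ 0 := by
          have : (0 : ℤ) ≤ (q : ℤ) * p := by positivity
          linarith
        exact not_isSoluble_real_twoIsogenyQuartic_of_neg hneg hd'neg ha hreal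
      · exact hpos
    -- the `q`-classes die at `q`
    have hqd : ¬ (q : ℤ) ∣ d := by
      rintro ⟨e, rfl⟩
      have h1 : e * d' = 112 * q * p ^ 2 := mul_left_cancel₀ hq0 (by linear_combination (-1 : ℤ) * hdd')
      have h3 : (q : ℤ) ∣ e * d' := ⟨112 * p ^ 2, by rw [h1]; ring⟩
      rcases hqZ.dvd_or_dvd h3 with h4 | h4
      · obtain ⟨e₁, rfl⟩ := h4
        exact hqZ.not_unit (hsqf (q : ℤ) ⟨e₁, by ring⟩)
      · obtain ⟨e', rfl⟩ := h4
        have hm : e * e' = 112 * p ^ 2 := mul_left_cancel₀ hq0 (by linear_combination h1)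
        exact not_isSoluble_padic_of_prime_dvd_coeffs (p := q) (c := -21 * p) (by ring) rfl rfl hm hns_disc_q (hpadic q)
    -- `d ∣ 14qp` prime to `q`: `d ∣ 14p`
    have h0 : d ∣ 112 * ((q : ℤ) * p) ^ 2 := ⟨d', hdd'⟩
    have h1 : d ∣ (14 * ((q : ℤ) * p)) ^ 4 := h0.trans ⟨343 * ((q : ℤ) * p) ^ 2, by ring⟩
    have h14qp : d ∣ 14 * ((q : ℤ) * p) := (hsqf.dvd_pow_iff_dvd (by norm_num)).mp h1
    have hcopq : IsCoprime d (q : ℤ) := ((hqZ.irreducible.coprime_iff_not_dvd).mpr hqd).symm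
    have h14p : d ∣ 14 * (p : ℤ) := by
      have : d ∣ (q : ℤ) * (14 * p) := by rw [show (q : ℤ) * (14 * p) = 14 * (q * p) by ring]; exact h14qp
      exact hcopq.dvd_of_dvd_mul_left this
    by_cases hpd : (p : ℤ) ∣ d
    · -- `d = p·e`, `e ∣ 14`, all four die at `q`
      exfalso
      obtain ⟨e, rfl⟩ := hpd
      have he14 : e ∣ 14 := by
        have : (p : ℤ) * e ∣ (p : ℤ) * 14 := by rw [mul_comm (p : ℤ) 14]; exact h14p
        exact (mul_dvd_mul_iff_left hp0).mp this
      have hepos : 0 < e := pos_of_mul_pos_right hdpos (by positivity)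
      have hele : e ≤ 14 := Int.le_of_dvd (by norm_num) he14
      have hd'e : e * d' = 112 * q ^ 2 * p := mul_left_cancel₀ hp0 (by linear_combination (-1 : ℤ) * hdd')
      interval_cases e <;> try omega
      · -- `d = p`: `d′ = q²·112p`
        exact not_isSoluble_padic_of_nonresidue_of_sq_dvd (p := q) (c := -21 * p) (e' := 112 * p) (by ring)
          (show d' = (q : ℤ) ^ 2 * (112 * p) by linarith) (by simpa using hns_p_q) hns_112p_q (hpadic q)
      · -- `d = 2p`: `d′ = q²·56p`
        exact not_isSoluble_padic_of_nonresidue_of_sq_dvd (p := q) (c := -21 * p) (e' := 56 * p) (by ring)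
          (show d' = (q : ℤ) ^ 2 * (56 * p) by linarith) hns_2p_q hns_56p_q (hpadic q)
      · -- `d = 7p`: `d′ = q²·16p`
        exact not_isSoluble_padic_of_nonresidue_of_sq_dvd (p := q) (c := -21 * p) (e' := 16 * p) (by ring)
          (show d' = (q : ℤ) ^ 2 * (16 * p) by linarith)
          (by rw [show ((p : ℤ) * 7 : ℤ) = (7 * p : ℤ) by ring]; exact hns_7p_q) hns_16p_q (hpadic q)
      · -- `d = 14p`: `d′ = q²·8p`
        exact not_isSoluble_padic_of_nonresidue_of_sq_dvd (p := q) (c := -21 * p) (e' := 8 * p) (by ring)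
          (show d' = (q : ℤ) ^ 2 * (8 * p) by linarith) hns_14p_q hns_8p_q (hpadic q)
    · -- `d ∣ 14`
      have hcopp : IsCoprime d (p : ℤ) := ((hpZ.irreducible.coprime_iff_not_dvd).mpr hpd).symm
      have hd14 : d ∣ 14 := hcopp.dvd_of_dvd_mul_right h14p
      have hle : d ≤ 14 := Int.le_of_dvd (by norm_num) hd14
      have hne2 : d ≠ 2 := by
        rintro rfl
        exact not_isSoluble_two_class_two_odd (u := -((q : ℤ) * p)) h8u (by ring) rfl (by linarith) (hpadic 2)
      have hne14 : d ≠ 14 := by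
        rintro rfl
        exact not_isSoluble_two_class_fourteen_odd (u := -((q : ℤ) * p)) h8u (by ring) rfl (by linarith) (hpadic 2)
      interval_cases d <;> first | (exfalso; omega) | simp
  exact (Finset.card_le_card hsub).trans Finset.card_le_two

end OddSelmerPOne

end Summit.BirchSwinnertonDyer.BirchSwinnertonDyer.Theorems.GoldfeldGoodTwists
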